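import Mathlib
import HarnessLib
import HarnessLib.Audit
import Summits.AnomalousDissipation.Statement
import Summits.AnomalousDissipation.AnomalousDissipation.Theorems.SteadyWeakLimitSteadyToSummit
import HarnessLib.Audit.Status.Attr

/-!
Route: NeutralTaylorWaves

DORMANT since 2026-08-25T09:01:23Z (reconciler: no traction for 7.6 d (last activity item-evidence-added at 2026-08-17T19:08:17Z); parked, not closed — `ledger route dormant route-AnomalousDissipation-NeutralTaylorWaves --off` to reacti) — unstaffed, not closed; items shared with open routes are served there. `ledger route dormant <id> --off` reactivates.

# Route NeutralTaylorWaves — neutral Taylor-scale Kelvin waves on a compact-vorticity vortex array,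
realised by nonresonant Newton

It suffices to show X = NonresonantTaylorWaves: ONE smooth steady divergence-free mean-zero force f
on T³, viscosities ν_n → 0⁺ and, for
every order K, smooth divergence-free mean-zero fields w_(K,n) (with pressures q and drift speeds c
along x₃) that are (i) LOUD and LIGHT,
∫|w|² ≤ E and ν_n‖∇w‖² = ε₀ + O(√ν_n) with ε₀ > 0, (ii) QUASI-STEADY TO ALL ORDERS with the SAME f,
‖w·∇w − ν_nΔw + ∇q − c∂₃w − f‖²_2 ≤ C_K ν_n^K,
and (iii) NONRESONANT modulo the x₃-phase along a subsequence: the bordered linearised steady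
operator at (w, c) obeys an a-priori bound
‖(v,b)‖ ≤ C₀ν_n^(−K₀)‖(L_w v + ∇r − c∂₃v − b∂₃w, ⟨v,∂₃w⟩)‖ with K₀, C₀ independent of K. The
intended witnesses realise the spine card
taylor-scale-neutral-kelvin-wave-equilibrium, repaired: a steady planar Euler vortex array U whose
vorticity F(ψ) is CONSTANT off an annular
band of closed streamlines (flat core plateau, irrotational separatrix network), dressed on the band
by one neutrally tuned oblique
elliptic-instability (Kelvin) wave of amplitude O(1) and wavelength √ν_n (phase S = m x₃ + G(ψ), a
first integral), with f := P div⟨V⊗V⟩_θ read off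
the wave stress. X splits as TaylorWaveQuasiSteady (construction, ∀n) and NonresonantSelection
(construction ⇒ X).
Lean: `∃ f : UnitAddTorus (Fin 3) → EuclideanSpace ℝ (Fin 3),
Literature.Analysis.FunctionSpaces.Torus.IsSmooth f ∧
Literature.Analysis.FunctionSpaces.Torus.IsDivFree f ∧
Literature.Analysis.FunctionSpaces.Torus.HasZeroMean f ∧ ∃ (ν : ℕ → ℝ) (E ε₀ C₀ : ℝ) (K₀ : ℕ), (∀ n,
0 < ν n) ∧ Filter.Tendsto ν Filter.atTop (nhds 0) ∧ 0 < ε₀ ∧ ∀ K : ℕ, ∃ C : ℝ, ∀ N : ℕ, ∃ n : ℕ, N ≤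
n ∧ ∃ (w : UnitAddTorus (Fin 3) → EuclideanSpace ℝ (Fin 3)) (q : UnitAddTorus (Fin 3) → ℝ) (c : ℝ),
Literature.Analysis.FunctionSpaces.Torus.IsSmooth w ∧
Literature.Analysis.FunctionSpaces.Torus.IsSmooth q ∧
Literature.Analysis.FunctionSpaces.Torus.IsDivFree w ∧
Literature.Analysis.FunctionSpaces.Torus.HasZeroMean w ∧ |c| ≤ C ∧ MeasureTheory.integral
MeasureTheory.volume (fun x => ‖w x‖ ^ 2) ≤ E ∧ |ν n *
Literature.Analysis.FunctionSpaces.Torus.gradNormSq w - ε₀| ≤ C * Real.sqrt (ν n) ∧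
MeasureTheory.integral MeasureTheory.volume (fun x =>
‖Literature.Analysis.FunctionSpaces.Torus.convect w w x - (ν n) •
Literature.Analysis.FunctionSpaces.Torus.laplacian w x +
Literature.Analysis.FunctionSpaces.Torus.gradient q x - c •
Literature.Analysis.FunctionSpaces.Torus.partialDeriv (2 : Fin 3) w x - f x‖ ^ 2) ≤ C * (ν n) ^ K ∧
(∀ x, ‖w x‖ ≤ C) ∧ (∀ (i : Fin 3) x, ‖Literature.Analysis.FunctionSpaces.Torus.partialDeriv i w x‖ ≤
C * (ν n)⁻¹) ∧ (∀ (i j : Fin 3) x, ‖Literature.Analysis.FunctionSpaces.Torus.partialDeriv i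
(Literature.Analysis.FunctionSpaces.Torus.partialDeriv j w) x‖ ≤ C * (ν n)⁻¹ ^ 2) ∧ ∀ (v :
UnitAddTorus (Fin 3) → EuclideanSpace ℝ (Fin 3)) (r : UnitAddTorus (Fin 3) → ℝ) (b : ℝ),
Literature.Analysis.FunctionSpaces.Torus.IsSmooth v →
Literature.Analysis.FunctionSpaces.Torus.IsSmooth r →
Literature.Analysis.FunctionSpaces.Torus.IsDivFree v →
Literature.Analysis.FunctionSpaces.Torus.HasZeroMean v → MeasureTheory.integral MeasureTheory.volume
(fun x => ‖v x‖ ^ 2) + b ^ 2 ≤ (C₀ * (ν n)⁻¹ ^ K₀) ^ 2 * (MeasureTheory.integral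
MeasureTheory.volume (fun x => ‖Literature.Analysis.FunctionSpaces.Torus.convect w v x +
Literature.Analysis.FunctionSpaces.Torus.convect v w x - (ν n) •
Literature.Analysis.FunctionSpaces.Torus.laplacian v x +
Literature.Analysis.FunctionSpaces.Torus.gradient r x - c •
Literature.Analysis.FunctionSpaces.Torus.partialDeriv (2 : Fin 3) v x - b •
Literature.Analysis.FunctionSpaces.Torus.partialDeriv (2 : Fin 3) w x‖ ^ 2) +
(MeasureTheory.integral MeasureTheory.volume (fun x => inner ℝ (v x)
(Literature.Analysis.FunctionSpaces.Torus.partialDeriv (2 : Fin 3) w x))) ^ 2)`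

## Assembly
Pure logic plus ONE landed theorem, certified in glue.lean (`closes`, rc 0 in Sketch.lean; crux-only
hypotheses): TaylorWaveQuasiSteady and
NonresonantSelection give NonresonantTaylorWaves (= X); NewtonRealisation turns X into the steady
zeroth-law family (stmt-0219 body: the drift c e₃ is
subtracted, W − c e₃ being an exact steady state of the same x₃-invariant force, energy ≤ 2E + 2c²);
the PROVED support of route SteadyWeakLimit,
`Theorems.steadyToSummit_proof : SteadyToSummit` (stmt-1311), is invoked inside the proof term
(import Theorems.SteadyWeakLimitSteadyToSummit) and
returns AnomalousDissipation. The target X is not a hypothesis of `closes`.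

Rationale: WHY THIS LINE. A bounded-energy witness with ν‖∇u‖² ≍ 1 and no cascade must put O(1) energy at
wavenumber ν^(-1/2) (the Taylor microscale: strain rate =
viscous rate); among non-cascading steady skeletons only a codimension-0 wave does this at bounded
energy (layers pay ε ≍ ν^(1/2), Burgers tubes
pay E ≍ log 1/ν — the accounting of route FrozenK41), and a steady single-phase microstructure can
live exactly where the co-moving wavevector
∇S is periodic: on closed streamlines, with S a first integral (Lifschitz–Hameiri
doi:10.1063/1.858155, Bayly doi:10.1103/physrevlett.57.2160,
Craik–Criminale doi:10.1098/rspa.1986.0061; large-amplitude monophase BKW on a linearly degenerate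
field: Cheverry–Guès–Métivier
doi:10.1016/j.ansens.2003.10.001, Cheverry arXiv:math/0402408). Imported: nonlinear geometric optics
(two-scale BKW hierarchies), short-wave
(elliptic) instability Floquet theory, steady vortex theory for the base array (Turkington
doi:10.1080/03605308308820293, Smets–Van Schaftingen
doi:10.1007/s00205-010-0293-y), and Newton–Kantorovich near quasi-solutions (Galdi2011) with the
pseudospectral caveat (doi:10.1137/0153002,
doi:10.1126/science.261.5121.578). What is new relative to the card: (a) the base array has
vorticity profile F with F′ supported exactly on the
wave band, which removes the order-ν Prandtl–Batchelor obstruction that kills the card's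
single-shell cell (there ∮νΔU·U dt = −νλ∮|U|² ≠ 0 on every
wave-free streamline and no free function is left; here νΔU = −νF′(ψ)U ≡ 0 off-band and the exterior
stays exactly potential to all orders);
(b) realisation is split into a ∀n construction crux and a LINEAR nonresonance crux, the steady
counterpart of Cheverry's cascade of phases,
decidable by parameter exclusion; (c) the x₃-translation symmetry is carried honestly (drift c,
bordered operator), and a drifting steady state
W − c e₃ is an exact steady state of the same force, so the line lands on SteadyZerothLaw
(stmt-0219) / SteadyToSummit (stmt-1311, proved).
No other open route uses two-scale oscillatory microstructure, instability-neutral tuning or inverse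
force design as its lever (36 route files
and the negatives index read 2026-08-16).

RANKED CRUXES. #0 NonresonantTaylorWaves (target) — X as in § Thesis: one fixed smooth force; ν_n →
0⁺; for every order K, loud (ν_n‖∇w‖² → ε₀ > 0), light (∫|w|² ≤ E), mean-zero smooth divergence-free
quasi-steady states with drift c and residual ‖·‖²₂ ≤ C_K ν_n^K, whose bordered linearisation
satisfies the polynomial a-priori bound with (K₀, C₀) independent of K, for infinitely many n. (why
it might fail: the local fast profile is a Kolmogorov flow at Re_fast ≍ ν^(-1/2): steady
bifurcations of the modulated profile (Meshalkin–Sinai) may cross 0 for a.e. n, or non-normality may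
make ‖L⁻¹‖ super-polynomial.) [doi:10.1016/0021-8928(62)90149-1, doi:10.1137/0153002,
doi:10.1126/science.261.5121.578, arXiv:math/0402408]
#2 NonresonantSelection (crux) — IF the fixed-force all-orders quasi-steady Taylor-wave family
exists (TaylorWaveQuasiSteady) THEN it can be chosen (amplitude profile A(ψ), axial number m,
subsequence of n) with uniform sup bounds |w| ≤ C, |∂w| ≤ Cν⁻¹, |∂∂w| ≤ Cν⁻² and the bordered
a-priori estimate ‖v‖²₂ + b² ≤ (C₀ν_n^(−K₀))²(‖w·∇v + v·∇w − ν_nΔv + ∇r − c∂₃v − b∂₃w‖²₂ + ⟨v,∂₃w⟩²)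
for all smooth mean-zero divergence-free v, smooth r, real b, along infinitely many n at every order
K (K₀, C₀ fixed): the steady form of "no cascade of phases". [deps: TaylorWaveQuasiSteady]
[difficulty: XL] (why it might fail: eigenvalues σ(ψ,k′) − ν|k′|² of the sea of longer elliptic
waves and steady Kolmogorov-type bifurcations of the fast profile accumulate at 0 with spacing ≲
ν^(3/2); exact or super-polynomially near resonances for all large n, or pseudospectral growth
exp(Re_fast^a), break any polynomial bound.) [doi:10.1137/0153002, doi:10.1126/science.261.5121.578,
doi:10.1016/0021-8928(62)90149-1, arXiv:math/0402408, doi:10.1016/j.ansens.2003.10.001]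
#3 TaylorWaveQuasiSteady (crux) — there are ONE smooth divergence-free mean-zero force f, ν_n → 0⁺,
E and ε₀ > 0 such that for every K there is C_K with, for EVERY n, smooth divergence-free mean-zero
w, smooth q and |c| ≤ C_K satisfying ∫|w|² ≤ E, |ν_n‖∇w‖² − ε₀| ≤ C_K√ν_n and ‖w·∇w − ν_nΔw + ∇q −
c∂₃w − f‖²₂ ≤ C_K ν_n^K. Intended proof: base array U (steady planar Euler, ω = F(ψ), F′ ≡ 0 off the
band, F′ ∝ A₀² on it), neutral oblique Kelvin wave V(x, S/√ν) on the band (Floquet multiplier of the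
damped Lifschitz–Hameiri cocycle tuned to 1 by the obliqueness G′(ψ); harmonics slaved), f := P
div⟨V⊗V⟩_θ, then the triangular monophase hierarchy with free (A_k, G_k, F_k, c_k) absorbing the
streamline circulation conditions order by order, ν_n = (m/2πn)². [difficulty: L] (why it might
fail: neutral tuning needs a real simple top multiplier with transversal crossing on a whole band
(fails on 4-fold-symmetric cores: the square cell is neutral); at order ν the circulation conditions
may outnumber the free functions (A_k,G_k,F_k,c_k) at band edges where A₀→0.) [doi:10.1063/1.858155,
doi:10.1103/physrevlett.57.2160, doi:10.1063/1.857682, doi:10.1063/1.869607,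
doi:10.1016/j.ansens.2003.10.001, arXiv:math/0402408, doi:10.1137/0145046,
doi:10.1080/03605308308820293, doi:10.1007/s00205-010-0293-y]
#4 NewtonRealisation (crux) — Newton–Kantorovich realisation: NonresonantTaylorWaves ⇒ the steady
zeroth-law family (stmt-0219 body, up to a binder name). For K large (given K₀ and the polynomial
H²-bookkeeping ‖v‖_H² ≲ ν⁻¹(‖L v‖ + ‖w‖_∞‖∇v‖ + ‖∇w‖_∞‖v‖)) the bordered map (v,b) ↦ (P[(w+v)·∇(w+v)
− νΔ(w+v) − (c+b)∂₃(w+v)] − f, ⟨v,∂₃w⟩) has a zero (v_n, b_n) with ‖v_n‖_H² ≤ ν_n² along the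
subsequence (Fredholm index 0 + injectivity bound ⇒ inverse bound C₀ν^(−K₀)·poly(ν⁻¹); residual
ν^(K/2) wins); then u_n := w + v_n − (c + b_n)e₃ is an exact smooth STEADY state of NS_ν_n(f) (the
drift is absorbed into the mean: (W − ce₃)·∇(W − ce₃) = W·∇W − c∂₃W), with ∫|u_n|² ≤ 2E + 2C² and
ν_n‖∇u_n‖² ≥ ε₀/2. [deps: NonresonantSelection] [difficulty: L] (why it might fail: the L²-level
bordered injectivity bound must upgrade to an H²→L² inverse with only polynomial loss; each
bootstrap pays ν⁻¹‖∇w‖_∞ ≍ ν⁻² and the Fredholm-index-0 claim with drift and border needs care — a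
super-polynomial loss lets no finite order K win.) [Galdi2011, Temam1979, doi:10.1137/0153002,
doi:10.1098/rspa.1986.0061]

TWO-LAYER PLAN. TaylorWaveQuasiSteady ⇐ NeutralProfileFamily → AllOrdersHierarchy →
TaylorWaveQuasiSteady (k = 2): NeutralProfileFamily = for a pinned compact-vorticity
rectangular (1:2) vortex array U and a fixed axial number m, on the band: damped Lifschitz–Hameiri
exponent positive at the optimal obliqueness, real
simple top multiplier, transversality in G′, and the Crandall–Rabinowitz branch of θ-periodic
nonlinear profiles V(·;ψ,A) with detuning G′(ψ;A) —
typed once a two-scale profile vocabulary (profile on T³×𝕋, evaluation at S/ε, θ-mean) is defined;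
AllOrdersHierarchy = the triangular solvability
of the steady monophase hierarchy with fixed f (free A_k, G_k, F_k, c_k against the cokernel {g(ψ)U}
of the linearised steady Euler operator at U,
which is EMPTY off-band because F′ = 0 there). NonresonantSelection ⇐ SpectralGap(mod phase) at the
LEADING-order two-scale operator → stability
of the bound under O(ν^(K/2)) first-order perturbations (k = 2). Nothing filed now.

KILL CRITERIA. SteadyNeg (stmt-AnomalousDissipation-0222) proved ⇒ every bounded steady family is
quiet ⇒ NewtonRealisation's conclusion is empty and X is
false: close `refuted:NonresonantTaylorWaves`. ¬TaylorWaveQuasiSteady in the strong form "no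
fixed-force loud light quasi-steady family even at
order K = 1" (e.g. a theorem that O(√ν)-accurate steady quasi-solutions with ν‖∇w‖² ↛ 0 force ∫|w|²
→ ∞) kills the whole witness class: close
`refuted:TaylorWaveQuasiSteady`. A proof that the bordered linearisation at ANY such family has
‖L⁻¹‖ ≥ exp(ν^(−a)) (pseudospectral no-go) refutes
NonresonantSelection only — pivot to a non-perturbative realisation (degree / continuation in the
amplitude of f) or retire. SteadyZerothLaw (0219)
or the summit proved elsewhere moots the route; its construction then documents an explicit witness
class.

NOT DECOMPOSED YET. The neutral Floquet family and the nonlinear profile bifurcation (layer-2 child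
of TaylorWaveQuasiSteady, needs the two-scale vocabulary); the
existence/choice of the base array U (variational steady vortex arrays with prescribed plateau
profile F, rectangular symmetry class — provable
with work, support-level); the H² bookkeeping constants of the Newton step; the measure-theoretic
parameter exclusion in (m, n) behind
NonresonantSelection; the first-order (K = 1) special case of TaylorWaveQuasiSteady as a separate
cheap deliverable.

CHEAPEST FALSIFIER. (i) DONE analytically (planner, this session): the order-ν
streamline-circulation test deciding which base flows admit an all-orders steady
monophase hierarchy with FIXED f — for steady planar Euler U with ω = F(ψ), νΔU = −νF′(ψ)U and the
cokernel of the linearised steady Euler operator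
contains every g(ψ)U, so a wave-free closed streamline needs F′(ψ)∮|U|²dt = 0: the card's
single-shell cell (F′ = λ ≠ 0) FAILS off its band, the
compact-vorticity plateau array (F′ = 0 off-band) PASSES — hence the repaired base flow. (ii) The
card's validated Lifschitz–Hameiri Floquet scan
(evidence-lh-floquet.txt): 1:2 cell PASSES (Λ₀,max = 1.96–4.44, real simple hyperbolic top
multiplier on ψ₀ ∈ [0.04, 0.148]), square cell FAILS —
to be re-run on the compact-vorticity rectangular array (same 2-fold strain; growth ≈ (9/16)·strain
at weak ellipticity). (iii) Decisive for rank 2,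
one kit job not run this cycle: zero-frequency Orr–Sommerfeld/Bloch spectrum of the frozen local
profile V(θ;ψ) for Re_fast = 10²–10⁴ — real
eigenvalue branches crossing 0 at O(1) density in log Re is the concrete face of resonance.

NUMBERS. Taylor scaling: wavelength √ν, amplitude O(1), Re_λ ≍ ν^(-1/2); dissipation ν_n‖∇w‖² → ε₀ =
∫|∇S|²⟨|∂_θV₀|²⟩; residual exponents K/2 per order;
elliptic-instability growth at weak strain ε_s: σ_max ≈ (9/16)ε_s (Waleffe doi:10.1063/1.857682),
viscous cut-off k_c = (σ/ν)^(1/2) (Kerswell 2002);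
card's band data: Λ₀,max = 1.96–4.44 at G′/m = 1.07–3.0, neutral axial number m* = 0.83–1.05 (1:2
cell); Kolmogorov-flow threshold Re_c = √2
(Meshalkin–Sinai); resolvent norms of shear flows at real frequency ∝ Re² (Trefethen et al. 1993).
Items: 5 (1 target, 3 cruxes, 1 assembly).

DEFINITION REQUESTS. None at open: the typed items use only
Torus.IsSmooth/IsDivFree/HasZeroMean/convect/laplacian/gradient/partialDeriv/gradNormSq and
Torus.IsClassicalNSSolutionOn. The two-scale profile vocabulary (profile V : T³ × 𝕋 → ℝ³, evaluation
x ↦ V(x, S(x)/ε), θ-mean) is wanted only for the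
layer-2 children and will be requested when TaylorWaveQuasiSteady is split.

Novelty: Searches (2026-08-16): hub: all 36 open route files' levers + 8 closed (table in NOTES), `ledger
negatives` (6), barrier catalogue (17 files), card
index (120 cards; nearest: taylor-scale-neutral-kelvin-wave-equilibrium = spine,
dodger-frame-couette-without-walls, inverse-design-quiet-branch,
elliptic-avalanche, frozen-turbulence, landau-count, lagrangian-echo); `lit search --source
crossref` ×9 ("elliptical instability steady state nonlinear
saturation Kelvin waves" → Le Reun–Favier–Le Bars 2019 only time-dependent; "large amplitude high
frequency waves quasilinear hyperbolic Cheverry Gues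
Metivier" → doi:10.57262/ade/1355867926, doi:10.1016/j.ansens.2003.10.001, Levenshtam 2024; "steady
Navier-Stokes vanishing viscosity oscillatory
shear layers exact solutions" → nothing relevant; "desingularization point vortex lattice steady
Euler periodic array" → Schochet 1996, Cao–Wan–Zhan
2021; DOI checks ×5), `lit search --hybrid` local ("Lifschitz Hameiri geometric optics instability"
→ Drazin 2002, Meyer 1981 textbook hits only),
`lit galaxy search "elliptical instability" --star pdf` (25 rows: precession/libration/tidal
elliptic instability, Le Dizès Kelvin modes — none steady-NS
or zeroth-law), `lit galaxy search "cascade of phases in turbulent flows" --star all` (0), `lit read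
arXiv:math/0402408` pp. 1–3 (Cheverry: monophase BKW
u₀ + Σ ε^(k/l)U_k(t,x,φ/ε), 'turbulent' regime l ≥ 3, Cauchy problem on [0,T], no steady states, no
force design); arXiv API returned 0 rows for 3
queri  [refs: 10.57262/ade/1355867926, 10.1016/j.ansens.2003.10.001, 10.1063/1.858155, 10.1103/physrevlett.57.2160, 10.1063/1.869607, math/0402408, doi:10.57262/ade/1355867926, doi:10.1016/j.ansens.2003.10.001, doi:10.1063/1.858155, doi:10.1103/physrevlett.57.2160, doi:10.1063/1.869607]

Barriers (technique_class: two-scale-bkw elliptic-instability newton-kantorovich): - technique_class: two-scale-bkw elliptic-instability newton-kantorovich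
- Literature.Barriers.AnomalousDissipation.BuckmasterVicol2019_thm13: evaded — no convex integration
and no iteration of scales; one phase at the Taylor scale, viscosity balances the wave exactly, so
H¹ is controlled by design (ν‖∇w‖² → ε₀) and the realised states are classical steady states, a
fortiori Leray–Hopf.
- Literature.Barriers.AnomalousDissipation.DrivasEyink2019_lemma1_measurable: respected, not engaged
— amplitude O(1) at wavelength √ν makes every uniform B^σ_(3,∞) bound (σ > 0) fail; the witnesses
are maximally sub-Onsager, as the barrier demands.
- Literature.Barriers.AnomalousDissipation.DeRosaDrivasInversi2024_thm12_bounded: consistent —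
ν_n|∇u_n|² ⇀ |∇S|²⟨|∂_θV|²⟩dx is absolutely continuous and space-filling on the band (dimension 3),
exactly the support bounded witnesses must have; this is why waves (codim 0) and not sheets or
tubes.
- Literature.Barriers.AnomalousDissipation.DeRosaInversi2024_thm12: not engaged — the family is not
uniformly BV (|Dw_n|(T³) ≍ ν^(-1/2)).
- Literature.Barriers.AnomalousDissipation.BrueDeLellis2023_noAnomaly_beforeEulerSingularity: not
engaged (with BrenierDeLellisSzekelyhidi2011_cor1 and Cheskidov2023_thm21): no finite-window claim
from fixed data; ν-indexed steady states.
- Literature.Barriers.AnomalousDissipation.AlexakisDoering2006_energyDissipationBound: evaded by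
genuine three-dimensionality — the wave needs m ≠ 0 (axial wavevectors are damped, planar

History (route lifecycle, newest last):
- 2026-08-16T18:18:07Z · rev 1: restated Assembly (stmt-AnomalousDissipation-16297) — crux-only closes (D-0027 needs_repair glue.non-crux-hypothesis): drop supports SteadyToSummit (the PROVED steadyToSummit_proof of stmt-1311 is invoked inside cl (planner-plan-novel-AnomalousDissipation-Anomalo-efd7bd3a-v2-)
- 2026-08-16T18:18:07Z · rev 1: dropped SteadyToSummit, NewtonSteadyRealisation — crux-only closes (D-0027 needs_repair glue.non-crux-hypothesis): drop supports SteadyToSummit (the PROVED steadyToSummit_proof of stmt-1311 is invoked inside cl (planner-plan-novel-AnomalousDissipation-Anomalo-efd7bd3a-v2-)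
- 2026-08-25T09:01:23Z · DORMANT — reconciler: no traction for 7.6 d (last activity item-evidence-added at 2026-08-17T19:08:17Z); parked, not closed — `ledger route dormant route-AnomalousDissipa (operator:999:3281810)

sub-problem: AnomalousDissipation · status: dormant · opened planner-plan-novel-AnomalousDissipation-Anomalo-efd7bd3a-v2-g5-0 2026-08-16T18:15:41Z · rev 2 · ledger route-AnomalousDissipation-NeutralTaylorWaves
GENERATED by the gate from the ledger (D-0016/17). Provers cite these decls: `theorem foo : Summit.AnomalousDissipation.AnomalousDissipation.Theses.NeutralTaylorWaves.<Decl> := …` in Summits/AnomalousDissipation/AnomalousDissipation/Theorems/<Name>.lean.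
-/

namespace Summit.AnomalousDissipation.AnomalousDissipation.Theses.NeutralTaylorWaves

open scoped BigOperators Topology Manifold Classical MeasureTheory ProbabilityTheory Matrix InnerProductSpace ComplexConjugate ContinuousMap
open Filter Set Function TopologicalSpace MeasureTheory

attribute [summit_statement] _root_.AnomalousDissipation

open Literature.Turb

/-- item stmt-AnomalousDissipation-16292 · target · rank 0 · open · by planner
why it might fail: the local fast profile is a Kolmogorov flow at Re_fast ≍ ν^(-1/2): steady bifurcations of the modulated profile (Meshalkin–Sinai) may cross 0 for a.e. n, or non-normality may make ‖L⁻¹‖ super-polynomial.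
sources: doi:10.1016/0021-8928(62)90149-1, doi:10.1137/0153002, doi:10.1126/science.261.5121.578, arXiv:math/0402408
[target] X as in § Thesis: one fixed smooth force; ν_n → 0⁺; for every order K, loud (ν_n‖∇w‖² → ε₀
> 0), light (∫|w|² ≤ E), mean-zero smooth divergence-free quasi-steady states with drift c and
residual ‖·‖²₂ ≤ C_K ν_n^K, whose bordered linearisation satisfies the polynomial a-priori bound
with (K₀, C₀) independent of K, for infinitely many n. -/
@[route_item "route-AnomalousDissipation-NeutralTaylorWaves"]
def NonresonantTaylorWaves : Prop :=
  ∃ f : UnitAddTorus (Fin 3) → EuclideanSpace ℝ (Fin 3), Literature.Analysis.FunctionSpaces.Torus.IsSmooth f ∧ Literature.Analysis.FunctionSpaces.Torus.IsDivFree f ∧ Literature.Analysis.FunctionSpaces.Torus.HasZeroMean f ∧ ∃ (ν : ℕ → ℝ) (E ε₀ C₀ : ℝ) (K₀ : ℕ), (∀ n, 0 < ν n) ∧ Filter.Tendsto ν Filter.atTop (nhds 0) ∧ 0 < ε₀ ∧ ∀ K : ℕ, ∃ C : ℝ, ∀ N : ℕ, ∃ n : ℕ, N ≤ n ∧ ∃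 (w : UnitAddTorus (Fin 3) → EuclideanSpace ℝ (Fin 3)) (q : UnitAddTorus (Fin 3) → ℝ) (c : ℝ), Literature.Analysis.FunctionSpaces.Torus.IsSmooth w ∧ Literature.Analysis.FunctionSpaces.Torus.IsSmooth q ∧ Literature.Analysis.FunctionSpaces.Torus.IsDivFree w ∧ Literature.Analysis.FunctionSpaces.Torus.HasZeroMean w ∧ |c| ≤ C ∧ MeasureTheory.integral MeasureTheory.volume (fun x => ‖w x‖ ^ 2) ≤ E ∧ |ν n * Literature.Analysis.FunctionSpaces.Torus.gradNormSq w - ε₀| ≤ C * Real.sqrt (ν n) ∧ MeasureTheory.integral MeasureTheory.volume (fun x => ‖Literature.Analysis.FunctionSpaces.Torus.convect w w x - (ν n) • Literature.Analysis.FunctionSpaces.Torus.laplacian w x + Literature.Analysis.FunctionSpaces.Torus.gradient q x - c • Literature.Analysis.FunctionSpaces.Torus.partialDeriv (2 : Fin 3) w x - f x‖ ^ 2) ≤ C * (ν n) ^ K ∧ (∀ x, ‖w x‖ ≤ C) ∧ (∀ (i : Fin 3) x, ‖Literature.Analysis.FunctionSpaces.Torus.partialDeriv i w x‖ ≤ C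 * (ν n)⁻¹) ∧ (∀ (i j : Fin 3) x, ‖Literature.Analysis.FunctionSpaces.Torus.partialDeriv i (Literature.Analysis.FunctionSpaces.Torus.partialDeriv j w) x‖ ≤ C * (ν n)⁻¹ ^ 2) ∧ ∀ (v : UnitAddTorus (Fin 3) → EuclideanSpace ℝ (Fin 3)) (r : UnitAddTorus (Fin 3) → ℝ) (b : ℝ), Literature.Analysis.FunctionSpaces.Torus.IsSmooth v → Literature.Analysis.FunctionSpaces.Torus.IsSmooth r → Literature.Analysis.FunctionSpaces.Torus.IsDivFree v → Literature.Analysis.FunctionSpaces.Torus.HasZeroMean v → MeasureTheory.integral MeasureTheory.volume (fun x => ‖v x‖ ^ 2) + b ^ 2 ≤ (C₀ * (ν n)⁻¹ ^ K₀) ^ 2 * (MeasureTheory.integral MeasureTheory.volume (fun x => ‖Literature.Analysis.FunctionSpaces.Torus.convect w v x + Literature.Analysis.FunctionSpaces.Torus.convect v w x - (ν n) • Literature.Analysis.FunctionSpaces.Torus.laplacian v x + Literature.Analysis.FunctionSpaces.Torus.gradient r x - c • Literature.Analysis.FunctionSpaces.Torus.partialDeriv (2 : Fin 3) v x - b • Literature.Analysis.FunctionSpaces.Torus.partialDeriv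 (2 : Fin 3) w x‖ ^ 2) + (MeasureTheory.integral MeasureTheory.volume (fun x => inner ℝ (v x) (Literature.Analysis.FunctionSpaces.Torus.partialDeriv (2 : Fin 3) w x))) ^ 2)

/-- item stmt-AnomalousDissipation-16294 · crux · rank 2 · open · by planner
why it might fail: eigenvalues σ(ψ,k′) − ν|k′|² of the sea of longer elliptic waves and steady Kolmogorov-type bifurcations of the fast profile accumulate at 0 with spacing ≲ ν^(3/2); exact or super-polynomially near resonances for all large n, or pseudospectral growth exp(Re_fast^a), break any polynomial bound.
sources: doi:10.1137/0153002, doi:10.1126/science.261.5121.578, doi:10.1016/0021-8928(62)90149-1, arXiv:math/0402408, doi:10.1016/j.ansens.2003.10.001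
[crux] IF the fixed-force all-orders quasi-steady Taylor-wave family exists (TaylorWaveQuasiSteady)
THEN it can be chosen (amplitude profile A(ψ), axial number m, subsequence of n) with uniform sup
bounds |w| ≤ C, |∂w| ≤ Cν⁻¹, |∂∂w| ≤ Cν⁻² and the bordered a-priori estimate ‖v‖²₂ + b² ≤
(C₀ν_n^(−K₀))²(‖w·∇v + v·∇w − ν_nΔv + ∇r − c∂₃v − b∂₃w‖²₂ + ⟨v,∂₃w⟩²) for all smooth mean-zero
divergence-free v, smooth r, real b, along infinitely many n at every order K (K₀, C₀ fixed): the
steady form of "no cascade of phases". [deps: TaylorWaveQuasiSteady] [difficulty: XL] -/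
@[route_item "route-AnomalousDissipation-NeutralTaylorWaves", crux]
def NonresonantSelection : Prop :=
  (∃ f : UnitAddTorus (Fin 3) → EuclideanSpace ℝ (Fin 3), Literature.Analysis.FunctionSpaces.Torus.IsSmooth f ∧ Literature.Analysis.FunctionSpaces.Torus.IsDivFree f ∧ Literature.Analysis.FunctionSpaces.Torus.HasZeroMean f ∧ ∃ (ν : ℕ → ℝ) (E ε₀ : ℝ), (∀ n, 0 < ν n) ∧ Filter.Tendsto ν Filter.atTop (nhds 0) ∧ 0 < ε₀ ∧ ∀ K : ℕ, ∃ C : ℝ, ∀ n : ℕ, ∃ (w : UnitAddTorus (Fin 3) → EuclideanSpace ℝ (Fin 3)) (q : UnitAddTorus (Fin 3) → ℝ) (c : ℝ), Literature.Analysis.FunctionSpaces.Torus.IsSmooth w ∧ Literature.Analysis.FunctionSpaces.Torus.IsSmooth q ∧ Literature.Analysis.FunctionSpaces.Torus.IsDivFree w ∧ Literature.Analysis.FunctionSpaces.Torus.HasZeroMean w ∧ |c| ≤ C ∧ MeasureTheory.integral MeasureTheory.volume (fun x => ‖w x‖ ^ 2) ≤ E ∧ |ν n * Literature.Analysis.FunctionSpaces.Torus.gradNormSq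 w - ε₀| ≤ C * Real.sqrt (ν n) ∧ MeasureTheory.integral MeasureTheory.volume (fun x => ‖Literature.Analysis.FunctionSpaces.Torus.convect w w x - (ν n) • Literature.Analysis.FunctionSpaces.Torus.laplacian w x + Literature.Analysis.FunctionSpaces.Torus.gradient q x - c • Literature.Analysis.FunctionSpaces.Torus.partialDeriv (2 : Fin 3) w x - f x‖ ^ 2) ≤ C * (ν n) ^ K) → NonresonantTaylorWaves

/-- item stmt-AnomalousDissipation-16293 · crux · rank 3 · open · by planner
why it might fail: neutral tuning needs a real simple top multiplier with transversal crossing on a whole band (fails on 4-fold-symmetric cores: the square cell is neutral); at order ν the circulation conditions may outnumber the free functions (A_k,G_k,F_k,c_k) at band edges where A₀→0.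
sources: doi:10.1063/1.858155, doi:10.1103/physrevlett.57.2160, doi:10.1063/1.857682, doi:10.1063/1.869607, doi:10.1016/j.ansens.2003.10.001, arXiv:math/0402408
[crux] there are ONE smooth divergence-free mean-zero force f, ν_n → 0⁺, E and ε₀ > 0 such that for
every K there is C_K with, for EVERY n, smooth divergence-free mean-zero w, smooth q and |c| ≤ C_K
satisfying ∫|w|² ≤ E, |ν_n‖∇w‖² − ε₀| ≤ C_K√ν_n and ‖w·∇w − ν_nΔw + ∇q − c∂₃w − f‖²₂ ≤ C_K ν_n^K.
Intended proof: base array U (steady planar Euler, ω = F(ψ), F′ ≡ 0 off the band, F′ ∝ A₀² on it),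
neutral oblique Kelvin wave V(x, S/√ν) on the band (Floquet multiplier of the damped
Lifschitz–Hameiri cocycle tuned to 1 by the obliqueness G′(ψ); harmonics slaved), f := P div⟨V⊗V⟩_θ,
then the triangular monophase hierarchy with free (A_k, G_k, F_k, c_k) absorbing the streamline
circulation conditions order by order, ν_n = (m/2πn)². [difficulty: L] -/
@[route_item "route-AnomalousDissipation-NeutralTaylorWaves", crux]
def TaylorWaveQuasiSteady : Prop :=
  ∃ f : UnitAddTorus (Fin 3) → EuclideanSpace ℝ (Fin 3), Literature.Analysis.FunctionSpaces.Torus.IsSmooth f ∧ Literature.Analysis.FunctionSpaces.Torus.IsDivFree f ∧ Literature.Analysis.FunctionSpaces.Torus.HasZeroMean f ∧ ∃ (ν : ℕ → ℝ) (E ε₀ : ℝ), (∀ n, 0 < ν n) ∧ Filter.Tendsto ν Filter.atTop (nhds 0) ∧ 0 < ε₀ ∧ ∀ K : ℕ, ∃ C : ℝ, ∀ n : ℕ, ∃ (w : UnitAddTorus (Fin 3) → EuclideanSpace ℝ (Fin 3)) (q : UnitAddTorus (Fin 3) → ℝ) (c : ℝ), Literature.Analysis.FunctionSpaces.Torus.IsSmooth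 w ∧ Literature.Analysis.FunctionSpaces.Torus.IsSmooth q ∧ Literature.Analysis.FunctionSpaces.Torus.IsDivFree w ∧ Literature.Analysis.FunctionSpaces.Torus.HasZeroMean w ∧ |c| ≤ C ∧ MeasureTheory.integral MeasureTheory.volume (fun x => ‖w x‖ ^ 2) ≤ E ∧ |ν n * Literature.Analysis.FunctionSpaces.Torus.gradNormSq w - ε₀| ≤ C * Real.sqrt (ν n) ∧ MeasureTheory.integral MeasureTheory.volume (fun x => ‖Literature.Analysis.FunctionSpaces.Torus.convect w w x - (ν n) • Literature.Analysis.FunctionSpaces.Torus.laplacian w x + Literature.Analysis.FunctionSpaces.Torus.gradient q x - c • Literature.Analysis.FunctionSpaces.Torus.partialDeriv (2 : Fin 3) w x - f x‖ ^ 2) ≤ C * (ν n) ^ K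

/-- item stmt-AnomalousDissipation-16315 · crux · rank 4 · closed · proved by Summit.AnomalousDissipation.AnomalousDissipation.Theorems.newtonRealisation_proof @ 71c7036857fb (prover) · by planner
why it might fail: the L²-level bordered injectivity bound must upgrade to an H²→L² inverse with only polynomial loss; each bootstrap pays ν⁻¹‖∇w‖_∞ ≍ ν⁻² and the Fredholm-index-0 claim with drift and border needs care — a super-polynomial loss lets no finite order K win.
sources: Galdi2011, Temam1979, doi:10.1137/0153002, doi:10.1098/rspa.1986.0061
[crux] Newton–Kantorovich realisation: NonresonantTaylorWaves ⇒ steady zeroth-law family (stmt-0219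
body): bordered Newton in H² along the nonresonant subsequence for K large, drift absorbed into the
mean (W − c e₃ is an exact steady state of the same x₃-invariant force), energy ≤ 2E+2C²,
dissipation ≥ ε₀/2. [deps: NonresonantSelection] [difficulty: L] -/
@[route_item "route-AnomalousDissipation-NeutralTaylorWaves", crux]
def NewtonRealisation : Prop :=
  NonresonantTaylorWaves → (∃ f : UnitAddTorus (Fin 3) → EuclideanSpace ℝ (Fin 3), Literature.Analysis.FunctionSpaces.Torus.IsSmooth f ∧ Literature.Analysis.FunctionSpaces.Torus.IsDivFree f ∧ Literature.Analysis.FunctionSpaces.Torus.HasZeroMean f ∧ ∃ (ν : ℕ → ℝ) (u : ℕ → UnitAddTorus (Fin 3) → EuclideanSpace ℝ (Fin 3)) (p : ℕ → UnitAddTorus (Fin 3) → ℝ), (∀ j, 0 < ν j) ∧ Filter.Tendsto ν Filter.atTop (nhds 0) ∧ (∀ j, Literature.Analysis.FunctionSpaces.Torus.IsClassicalNSSolutionOn Set.univ (ν j) (fun _ => f) (fun _ => u j) (fun _ => p j)) ∧ (∃ E : ℝ, ∀ j, MeasureTheory.integral MeasureTheory.volume (fun x => ‖u j x‖ ^ 2)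 ≤ E) ∧ ∃ ε₁ : ℝ, 0 < ε₁ ∧ ∀ j, ε₁ ≤ ν j * Literature.Analysis.FunctionSpaces.Torus.gradNormSq (u j))

-- earlier Assembly (stmt-AnomalousDissipation-16297, replaced 2026-08-16T18:18:07Z -> stmt-AnomalousDissipation-16314): retired by None — TaylorWaveQuasiSteady → NonresonantSelection → NewtonSteadyRealisation → SteadyToSummit → AnomalousDissipation
/-- item stmt-AnomalousDissipation-16314 · assembly · rank 1 · open · by planner
sources: stmt-AnomalousDissipation-1311, Galdi2011
[assembly] TaylorWaveQuasiSteady → NonresonantSelection → NewtonSteadyRealisation → SteadyToSummit →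
AnomalousDissipation. -/
@[route_item "route-AnomalousDissipation-NeutralTaylorWaves"]
def Assembly : Prop :=
  TaylorWaveQuasiSteady → NonresonantSelection → (NonresonantTaylorWaves → (∃ f : UnitAddTorus (Fin 3) → EuclideanSpace ℝ (Fin 3), Literature.Analysis.FunctionSpaces.Torus.IsSmooth f ∧ Literature.Analysis.FunctionSpaces.Torus.IsDivFree f ∧ Literature.Analysis.FunctionSpaces.Torus.HasZeroMean f ∧ ∃ (ν : ℕ → ℝ) (u : ℕ → UnitAddTorus (Fin 3) → EuclideanSpace ℝ (Fin 3)) (p : ℕ → UnitAddTorus (Fin 3) → ℝ), (∀ j, 0 < ν j) ∧ Filter.Tendsto ν Filter.atTop (nhds 0) ∧ (∀ j, Literature.Analysis.FunctionSpaces.Torus.IsClassicalNSSolutionOn Set.univ (ν j) (fun _ => f) (fun _ => u j) (fun _ => p j)) ∧ (∃ E : ℝ, ∀ j, MeasureTheory.integral MeasureTheory.volume (fun x => ‖u j x‖ ^ 2) ≤ E) ∧ ∃ ε₁ : ℝ, 0 < ε₁ ∧ ∀ j, ε₁ ≤ ν j * Literature.Analysis.FunctionSpaces.Torus.gradNormSq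 (u j))) → AnomalousDissipation

/-! D-0027 §2.1 — DECIDING THEOREM (planner-authored via `route open/edit --closes-file`; by planner-plan-novel-AnomalousDissipation-Anomalo-efd7bd3a-v2- 2026-08-16T18:18:07Z):
its hypotheses are this route's items and its conclusion the sub-problem Statement (glue_lint), and it elaborates with this file. -/

@[closes "route-AnomalousDissipation-NeutralTaylorWaves"] theorem closes (hA : TaylorWaveQuasiSteady) (hSel : NonresonantSelection) (hN : NewtonRealisation) : _root_.AnomalousDissipation :=
  Summit.AnomalousDissipation.AnomalousDissipation.Theorems.steadyToSummit_proof (hN (hSel hA))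

end Summit.AnomalousDissipation.AnomalousDissipation.Theses.NeutralTaylorWaves
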